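import Summits.BirchSwinnertonDyer.BirchSwinnertonDyer.Theorems.ByReductionTypeAtTwoMultTowerNS2LayerZeroFlipOdd
import HarnessLib

/-!
# Route `ByReductionTypeAtTwo`, crux `MultUpperHalfAtTwo` (item stmt-BirchSwinnertonDyer-19922), TOWER road, NON-SPLIT rows:
# the layer-`0` order of the local tower kernel at a non-split `2`, part 3 — when `ord₂(q_E)` is ODD every
# UNIT-EXPONENT `2^k`-torsion class of the layer-`0` coinvariants VANISHES

HONEST FRAMING (cell `bsd-2adic`, run/shared/lean/pub/bsd-2adic/, seat `bsd-2adic-tower-1` GEN 29, HUMAN RULINGS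
D-0036 / D-0054 / D-0074): TOOL theorems only (no definition, no named fact, no `sorry`); closes nothing by itself;
nothing booked; BSD is not proved by any of this. Third brick of the layer-`0` count `#𝒦_{v,0}[2^∞] = 2·c₂^{(2)}` at a
non-split multiplicative `2` (Greenberg LNM 1716 §3 p. 93 / §4 p. 113; scope memo `tower/SCOPE-NS2-LAYER0-EXACT-GEN29.md`,
structure `A_g[2^∞]` via `B = (T₀)_g/⟨[ε₁]⟩`: when `ord₂ q_E` is odd, `B[2^∞] = 0`). Same setting as parts 1–2.

* `exists_norm_eq_of_even_valuation` — a `Γ`-fixed `ν ≠ 0` of EVEN valuation `|ν| = |2|^{2d}` is a norm `f·τ₀f` from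
  `ℚ_v(t)` (part 2 `exists_norm_eq_of_unit` for `ν/2^{2d}`, times `2^d`);
* `exists_coboundary_of_unitExponent_of_odd` — **`ord₂ q_E` ODD: a unit-exponent `2^k`-torsion datum `x` (fixed by
  `H_∞ ∩ Stab t`, `τ₀x·x = 1`, `x^{2^k} = Qʲ·gz/z` with `z ∈ T`) is `x = g y/y` with `y ∈ T`** (`τ₀y·y = Q^a`): by GEN 27's
  C3 `exists_coboundary_of_pow_eq` at the layer `0`, `x = g y₀/y₀` with `ν = y₀·τ₀y₀ ∈ ℚ_vˣ`; `|ν| = |2|^e`; if `e` is even,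
  `ν⁻¹ = s·τ₀s` and `y = y₀ s` has norm `1`; if `e` is odd, `Q/ν` has even valuation (`ord₂ q_E` odd), `Q/ν = s·τ₀s` and
  `y = y₀ s` has norm `Q`; in both cases `s ∈ ℚ_v(t)` is `g`-fixed, so `g y/y = x`. In the coinvariants `M_∞/(g−1)M_∞`
  (`M_∞ = Ψ(T)`) this says `[Ψ(x)] = 0`: together with part 2 (`[Ψ(−1)] = 0`), the unit-exponent torsion classes all vanish
  when `c₂ = 1`, so at most ONE non-zero `2`-power-torsion class remains (odd exponent) — the upper bound `#𝒦_{v,0}[2^∞] ≤ 2`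
  is the assembly left to do (pattern: GEN 27 `powTorsion_localTowerKerPrimary_le_four_nonsplitTwo` with three data).

References: R. Greenberg, LNM 1716 (1999), §3 p. 93, §4 p. 113; J. Silverman, GTM 151, V.5; J. Neukirch, *ANT* IV (3.5), V (1.1).
-/

set_option autoImplicit false
-- the Theorems namespace of this sub repeats the summit name by design (D-0017 nested layout: Summit.<S>.<Sub>)
set_option linter.dupNamespace false

noncomputable section

open scoped Classical IntermediateField NNReal

namespace Summit.BirchSwinnertonDyer.BirchSwinnertonDyer.Theorems.MultTowerNS2LayerZero

open NumberField IsDedekindDomain Field WeierstrassCurve PadicInt Rat.HeightOneSpectrum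
  Literature.NumberTheory.EllipticCurves Literature.NumberTheory.GaloisRepresentations
  Summit.BirchSwinnertonDyer.BirchSwinnertonDyer.Theorems.MultTowerNS2 IsDedekindDomain.HeightOneSpectrum

variable {κ : ZpExtension ℚ 2}

/-! ### Elements of even valuation are norms from `ℚ_v(t)` -/

/-- **A `Γ`-fixed element of EVEN valuation is a norm from `ℚ_v(t)`**: if `σν = ν` for all `σ ∈ Γ_{ℚ_v}` and
`|ν|_v = |2|_v^{2d}` (so `ν ≠ 0`), then `ν = f·τ₀f` with `f ≠ 0` fixed by `Stab(t)` (`ν/2^{2d}` is a unit, a norm by part 2, and `2^{2d} =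
2^d·τ₀2^d`). [cite: NeukirchANT1999, Ch. V §1 Thm. (1.1)] [cite: SilvermanATAEC1994, Ch. V Lemma 5.2 (c)] -/
theorem exists_norm_eq_of_even_valuation (W : WeierstrassCurve ℚ) [W.IsElliptic] [W.IsGloballyMinimal]
    (hmult : W.HasMultiplicativeReductionAtPrime 2) (hκ : κ.IsCyclotomic) (v : HeightOneSpectrum (𝓞 ℚ))
    (hv : ((2 : ℕ) : 𝓞 ℚ) ∈ v.asIdeal) {t : AlgebraicClosure (v.adicCompletion ℚ)}
    (ht2 : t ^ 2 = algebraMap (v.adicCompletion ℚ) (AlgebraicClosure (v.adicCompletion ℚ))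
      (algebraMap ℚ (v.adicCompletion ℚ) (-(W.c₄ / W.c₆))))
    (ht : ∀ σ : absoluteGaloisGroup (v.adicCompletion ℚ), σ • t = t ∨ σ • t = -t) (ht0 : t ≠ 0)
    {τ₀ : absoluteGaloisGroup (v.adicCompletion ℚ)} (hτ₀t : τ₀ • t = -t)
    {w : Valuation (AlgebraicClosure (v.adicCompletion ℚ)) ℝ≥0}
    (hw : ∀ x, (w x : ℝ) = spectralNorm (v.adicCompletion ℚ) (AlgebraicClosure (v.adicCompletion ℚ)) x)
    {ν : AlgebraicClosure (v.adicCompletion ℚ)} (hνfix : ∀ σ : absoluteGaloisGroup (v.adicCompletion ℚ), σ • ν = ν)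
    {d : ℤ} (hνd : w ν = w 2 ^ (2 * d)) :
    ∃ f : AlgebraicClosure (v.adicCompletion ℚ), f ≠ 0 ∧
      (∀ σ : absoluteGaloisGroup (v.adicCompletion ℚ), σ • t = t → σ • f = f) ∧ ν = f * τ₀ • f := by
  set K := v.adicCompletion ℚ with hK
  have h20 : (2 : AlgebraicClosure K) ≠ 0 := by
    haveI : CharZero (AlgebraicClosure K) := charZero_of_injective_algebraMap (algebraMap ℚ (AlgebraicClosure K)).injective
    exact two_ne_zero
  have h2fix : ∀ σ : absoluteGaloisGroup K, σ • (2 : AlgebraicClosure K) = 2 := fun σ ↦ by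
    change absoluteGaloisGroup.toAlgEquiv K σ 2 = 2
    exact map_ofNat _ 2
  have hw20 : w 2 ≠ 0 := (Valuation.ne_zero_iff _).mpr h20
  -- the unit `c = ν / 2^{2d}`
  set c : AlgebraicClosure K := ν / (2 : AlgebraicClosure K) ^ (2 * d) with hc
  have hcfix : ∀ σ : absoluteGaloisGroup K, σ • c = c := fun σ ↦ by
    rw [hc, smul_div₀', hνfix, smul_zpow₀', h2fix]
  have hc1 : w c = 1 := by
    rw [hc, map_div₀, map_zpow₀, hνd, div_self (zpow_ne_zero _ hw20)]
  obtain ⟨f₀, hf₀0, hf₀S, hcf⟩ := exists_norm_eq_of_unit W hmult hκ v hv ht2 ht ht0 hτ₀t hw hcfix hc1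
  refine ⟨(2 : AlgebraicClosure K) ^ d * f₀, mul_ne_zero (zpow_ne_zero _ h20) hf₀0, fun σ hσt ↦ ?_, ?_⟩
  · rw [smul_mul', smul_zpow₀', h2fix, hf₀S σ hσt]
  · rw [smul_mul', smul_zpow₀', h2fix]
    have e : ν = (2 : AlgebraicClosure K) ^ (2 * d) * c := by
      rw [hc, mul_div_cancel₀ _ (zpow_ne_zero _ h20)]
    rw [e, hcf, two_mul, zpow_add₀ h20]
    ring

/-! ### Unit-exponent torsion classes vanish when `ord₂ q_E` is odd -/

/-- **`ord₂ q_E` ODD: every unit-exponent `2^k`-torsion datum is a coboundary of a `T`-element.** Setting of parts 1–2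
(`v ∋ 2`, `W` globally minimal multiplicative at `2`, `κ` cyclotomic, `t² = γ(W)`, flip `τ₀ ∈ H_∞`, generator `g` at the layer
`0` fixing `t`, `Q = q_E` with `|Q|_v = |2|_v^m`, `m` odd). If `x` is fixed by `H_∞ ∩ Stab(t)` with `τ₀x·x = 1` and
`x^{2^k} = Qʲ·(gz/z)` for some `z ∈ T` (`z ≠ 0` fixed by `H_∞ ∩ Stab(t)`, `τ₀z·z = Q^{j'}`), then `x = g y/y` for some `y ∈ T`
(`y ≠ 0` fixed by `H_∞ ∩ Stab(t)`, `τ₀y·y = Q^a`). Proof: C3 `exists_coboundary_of_pow_eq` gives `x = g y₀/y₀` with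
`ν = y₀τ₀y₀ ∈ ℚ_vˣ`, `|ν| = |2|^e`; `y = y₀s` with `s·τ₀s = ν⁻¹` (`e` even) or `= Q/ν` (`e` odd, using `m` odd), `s` fixed by
`Stab(t) ∋ g`. In `M_∞/(g−1)M_∞`: `[Ψ(x)] = 0`. [cite: GreenbergLNM1716, §3 p. 93 and §4 p. 113]
[cite: NeukirchANT1999, Ch. IV (3.5), Ch. V (1.1)] -/
theorem exists_coboundary_of_unitExponent_of_odd (W : WeierstrassCurve ℚ) [W.IsElliptic] [W.IsGloballyMinimal]
    (hmult : W.HasMultiplicativeReductionAtPrime 2) (hκ : κ.IsCyclotomic) (v : HeightOneSpectrum (𝓞 ℚ))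
    (hv : ((2 : ℕ) : 𝓞 ℚ) ∈ v.asIdeal) {t : AlgebraicClosure (v.adicCompletion ℚ)}
    (ht2 : t ^ 2 = algebraMap (v.adicCompletion ℚ) (AlgebraicClosure (v.adicCompletion ℚ))
      (algebraMap ℚ (v.adicCompletion ℚ) (-(W.c₄ / W.c₆))))
    (ht : ∀ σ : absoluteGaloisGroup (v.adicCompletion ℚ), σ • t = t ∨ σ • t = -t) (ht0 : t ≠ 0)
    {τ₀ : absoluteGaloisGroup (v.adicCompletion ℚ)} (hτ₀ : τ₀ ∈ localSubgroup κ.kerSubgroup (v.adicCompletion ℚ))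
    (hτ₀t : τ₀ • t = -t) {g : absoluteGaloisGroup (v.adicCompletion ℚ)} {u : ℤ_[2]ˣ}
    (hu : ((κ (resGal (K := ℚ) (v.adicCompletion ℚ) g)).toAdd : ℤ_[2]) = 2 ^ 0 * (u : ℤ_[2])) (hgt : g • t = t)
    {Q : AlgebraicClosure (v.adicCompletion ℚ)} (hQfix : ∀ σ : absoluteGaloisGroup (v.adicCompletion ℚ), σ • Q = Q)
    (hQ0 : Q ≠ 0) (hQtor : ∀ j : ℤ, Q ^ j = 1 → j = 0)
    {w : Valuation (AlgebraicClosure (v.adicCompletion ℚ)) ℝ≥0}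
    (hw : ∀ x, (w x : ℝ) = spectralNorm (v.adicCompletion ℚ) (AlgebraicClosure (v.adicCompletion ℚ)) x)
    {m : ℕ} (hQm : w Q = w 2 ^ m) (hm : Odd m)
    {x : AlgebraicClosure (v.adicCompletion ℚ)}
    (hxL : ∀ h ∈ localSubgroup κ.kerSubgroup (v.adicCompletion ℚ), h • t = t → h • x = x) (hxU : τ₀ • x * x = 1)
    (k : ℕ) {j : ℤ} {z : AlgebraicClosure (v.adicCompletion ℚ)} (hz0 : z ≠ 0)
    (hzL : ∀ h ∈ localSubgroup κ.kerSubgroup (v.adicCompletion ℚ), h • t = t → h • z = z)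
    {j' : ℤ} (hzj : τ₀ • z * z = Q ^ j') (hxk : x ^ 2 ^ k = Q ^ j * (g • z / z)) :
    ∃ (y : AlgebraicClosure (v.adicCompletion ℚ)) (a : ℤ), y ≠ 0 ∧
      (∀ h ∈ localSubgroup κ.kerSubgroup (v.adicCompletion ℚ), h • t = t → h • y = y) ∧
      τ₀ • y * y = Q ^ a ∧ x = g • y / y := by
  set K := v.adicCompletion ℚ with hK
  have h20 : (2 : AlgebraicClosure K) ≠ 0 := by
    haveI : CharZero (AlgebraicClosure K) := charZero_of_injective_algebraMap (algebraMap ℚ (AlgebraicClosure K)).injective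
    exact two_ne_zero
  have hw20 : w 2 ≠ 0 := (Valuation.ne_zero_iff _).mpr h20
  -- the layer `0`: `H₀ = Γ`
  have hmem0 : ∀ σ : absoluteGaloisGroup K, σ ∈ localSubgroup (κ.layerSubgroup 0) K := fun σ ↦ by
    rw [mem_localSubgroup_iff, ZpExtension.mem_layerSubgroup]
    exact ⟨(κ (resGal (K := ℚ) K σ)).toAdd, by rw [pow_zero, one_mul]⟩
  -- C3: `x = g y₀ / y₀` with `ν = y₀ τ₀ y₀` fixed by `Γ`
  obtain ⟨y₀, hy₀0, hy₀L, hxy₀, hν0, hνfix⟩ :=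
    exists_coboundary_of_pow_eq (κ := κ) v 0 hu ht hgt hτ₀ hτ₀t hQfix hQ0 hQtor hxL hxU k hz0 hzL hzj hxk
  set ν := y₀ * τ₀ • y₀ with hν
  have hνfix' : ∀ σ : absoluteGaloisGroup K, σ • ν = ν := fun σ ↦ hνfix σ (hmem0 σ)
  -- `|ν| = |2|^e`
  obtain ⟨e, he⟩ := exists_spectralValuation_eq_zpow_of_stabilizer W hmult v hv ht2 hw hν0 (fun σ _ ↦ hνfix' σ)
  -- the correcting norm `s τ₀ s = target / ν`, `target ∈ {1, Q}` of even valuation relative to `ν`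
  obtain ⟨a, d, htarget⟩ : ∃ (a d : ℤ), w (Q ^ a / ν) = w 2 ^ (2 * d) := by
    rcases Int.even_or_odd e with ⟨d, hd⟩ | he1
    · refine ⟨0, -d, ?_⟩
      rw [zpow_zero, map_div₀, map_one, he, one_div, ← zpow_neg, hd]
      ring_nf
    · obtain ⟨d, hd⟩ := (hm.natCast (R := ℤ)).sub_odd he1
      refine ⟨1, d, ?_⟩
      rw [zpow_one, map_div₀, hQm, he, ← zpow_natCast, ← zpow_sub₀ hw20, hd]
      ring_nf
  have hQafix : ∀ σ : absoluteGaloisGroup K, σ • (Q ^ a / ν) = Q ^ a / ν := fun σ ↦ by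
    rw [smul_div₀', smul_zpow₀', hQfix, hνfix']
  obtain ⟨s, hs0, hsS, hsN⟩ :=
    exists_norm_eq_of_even_valuation W hmult hκ v hv ht2 ht ht0 hτ₀t hw hQafix htarget
  -- `y = y₀ s`
  refine ⟨y₀ * s, a, mul_ne_zero hy₀0 hs0, fun h hh hht ↦ ?_, ?_, ?_⟩
  · rw [smul_mul', hy₀L h hh hht, hsS h hht]
  · rw [smul_mul']
    calc τ₀ • y₀ * τ₀ • s * (y₀ * s) = (y₀ * τ₀ • y₀) * (s * τ₀ • s) := by ring
      _ = ν * (Q ^ a / ν) := by rw [← hν, ← hsN]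
      _ = Q ^ a := mul_div_cancel₀ _ hν0
  · rw [smul_mul', hsS g hgt, mul_div_mul_right _ _ hs0]
    exact hxy₀

end Summit.BirchSwinnertonDyer.BirchSwinnertonDyer.Theorems.MultTowerNS2LayerZero

end
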